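import Summits.SmoothPoincare4.SmoothPoincare4.Theorems.ConvexBisectionAcyclicBisectionExistsEulerCounts
import Summits.SmoothPoincare4.SmoothPoincare4.Theorems.ConvexBisectionAcyclicBisectionExistsEulerHandleModels
import Summits.SmoothPoincare4.SmoothPoincare4.Theorems.ConvexBisectionAcyclicBisectionExistsEulerHandles
import Summits.SmoothPoincare4.SmoothPoincare4.Theorems.ConvexBisectionAcyclicBisectionExistsStubModelsOnCounts
import Literature.Topology.FourManifolds.LefschetzBaseHomologyRank
import Literature.AlgebraicTopology.SingularHomology.IntersectionFormProofs
import HarnessLib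

/-!
# `l.length = 4 * g` for a one-sided Lefschetz model of a homotopy 4-sphere, unconditionally
(sub-goal `stub_modelsOn_counts_length` of stub `stub_modelsOn_counts`, line `modp-braid-orbits`, reshape r9,
crux `ConvexBisection.AcyclicBisectionExists`, item stmt-SmoothPoincare4-10508)

The first clause of the named fact `LefschetzBase.modelsOn_counts_of_homotopyEquiv_sphere`
(Gompf–Stipsicz 1999, §8.2; Etnyre–Fuller 2006, §2), now WITHOUT hypotheses: if `M ≃ₕ S⁴` and
`ModelsOn M g l` (`M = X ∪_Ψ Base g` with `X` a Kosinski multi-attachment of `l.length` 2-handles on the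
base) then `l.length = 4 * g`.  On paper: `2 = χ(M) = χ(X) + χ(Base g) − χ(∂X)`,
`χ(X) = χ(Base g) + l.length`, `χ(∂X) = 0`, `χ(Base g) = 1 − 2g`.  Assembly of three accepted inputs:

* `stub_modelsOn_counts_length_of_betti` (`…EulerCounts.lean`): the count from (`hχ`) the Euler
  characteristic of 2-handle multi-attachments on the base and (`hB`) the rational Betti numbers of the base;
* `hχ` from `stub_modelsOn_counts_eulerHandles` (`…EulerHandles.lean`, inclusion–exclusion over the
  Kosinski tubes) fed with the four model Euler characteristics `stub_modelsOn_counts_eulerHandleModels 2`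
  (`…EulerHandleModels.lean`) — `χ(X) = χ(V) + n` (Kosinski 1993, VI §6 / Kirby 1989, I §1);
* `hB` = `LefschetzBase.bettiNumbers_base` (`Literature/Topology/FourManifolds/LefschetzBaseBetti.lean`,
  accepted (p120614) but not yet built on the farm when this file landed, hence consumed through PRIVATE
  copies `…'` of three of its lemmas below): `b₀ = 1`, `b₁ = 2g`, `bₖ = 0` for `k ≥ 2`, by Mayer–Vietoris
  over the Milnor cover of `Base g` (Milnor 1968, Thm. 9.1).

By-products: `relEuler_of_isLefschetzHandlebody` (`χ(X(F;l)) = 1 − 2g + l.length`) and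
`exists_isLefschetzHandlebody_of_modelsOn_sphere` — the gluing bookkeeping of `…StubModelsOnCounts.lean`
(`exists_isLefschetzHandlebody_of_modelsOn`) with its two inputs `H₂(Base g; ℚ) = H₃(Base g; ℚ) = 0`
discharged by `LefschetzBase.isZero_singularHomology_base_of_two_le`: the handlebody side of a one-sided
model of a homotopy 4-sphere is connected with `H₁(X; ℚ) = 0`.

No definitions, no named facts, no `sorry`.
-/

noncomputable section

-- the prescribed namespace `Summit.<P>.<Sub>.…` duplicates `SmoothPoincare4` (P = Sub)
set_option linter.dupNamespace false

open scoped Manifold ContDiff Topology ContinuousMap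
open Set Function CategoryTheory CategoryTheory.Limits
open Literature.AlgebraicTopology.SingularHomology Literature.Topology.FourManifolds
  Literature.Topology.FourManifolds.LefschetzBase

namespace Summit.SmoothPoincare4.SmoothPoincare4.Theorems.AcyclicBisectionExists.ModpBraidOrbits

/-! ## Private copies of the Betti numbers of the base (`LefschetzBaseBetti.lean`, accepted, not yet built) -/

section Copies

universe u v

variable (R : Type v) [CommRing R] (M' : Type v) [AddCommGroup M'] [Module R M']

/-- Mayer–Vietoris vanishing criterion for an open cover `X = U ∪ V`: `Hₙ₊₁(U) = Hₙ₊₁(V) = 0` and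
`Hₙ(U ∩ V) = 0` give `Hₙ₊₁(X) = 0` (Hatcher 2002, §2.2 p. 149).  Private copy of
`LefschetzBase.isZero_singularHomology_succ_of_cover`. [folklore] -/
private theorem isZero_singularHomology_succ_of_cover' {X : Type u} [TopologicalSpace X] (U V : Set X)
    (hU : IsOpen U) (hV : IsOpen V) (hUV : U ∪ V = univ) (n : ℕ)
    (hUn : IsZero (singularHomology R M' U (n + 1))) (hVn : IsZero (singularHomology R M' V (n + 1)))
    (hW : IsZero (singularHomology R M' ↥(U ∩ V) n)) : IsZero (singularHomology R M' X (n + 1)) := by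
  have h : interior U ∪ interior V = univ := by rw [hU.interior_eq, hV.interior_eq, hUV]
  have hexc := relativeSingularHomology.isIso_map_of_interior_union_interior_holds R M' X
  have hδ : mayerVietoris.δ R M' U V hexc h n = 0 := hW.eq_of_tgt _ _
  haveI : Epi (mayerVietoris.ψ R M' U V (n + 1)) := (mayerVietoris.exact₂_holds R M' U V hexc h n).epi_f hδ
  exact IsZero.of_epi (mayerVietoris.ψ R M' U V (n + 1)) ((biprod_isZero_iff _ _).2 ⟨hUn, hVn⟩)

/-- `Hₖ(Base g; M) = 0` for `k ≥ 2` (Milnor 1968, Thm. 9.1), by Mayer–Vietoris over the Milnor cover with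
homologically discrete pieces.  Private copy of `LefschetzBase.isZero_singularHomology_base_of_two_le`.
[folklore] -/
private theorem isZero_singularHomology_base_of_two_le' (g : ℕ) {k : ℕ} (hk : 2 ≤ k) :
    IsZero (singularHomology R M' (Base g) k) := by
  obtain ⟨n, rfl⟩ : ∃ n, k = n + 1 + 1 := ⟨k - 2, by omega⟩
  have hU : ContinuousMap.HomotopyEquiv ↥(coverU g) (Fin 2) := homotopyEquivU g
  have hV : ContinuousMap.HomotopyEquiv ↥(coverV g) (Fin (2 * g + 1)) := homotopyEquivV g
  have hW : ContinuousMap.HomotopyEquiv ↥(coverU g ∩ coverV g) (Fin 2 × Fin (2 * g + 1)) := homotopyEquivW g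
  refine isZero_singularHomology_succ_of_cover' R M' (coverU g) (coverV g) (isOpen_coverU g)
    (isOpen_coverV g) (coverU_union_coverV g) (n + 1) ?_ ?_ ?_
  · exact (singularHomology.isZero_fin R M' 2 (Nat.succ_ne_zero _)).of_iso
      (singularHomology.isoOfHomotopyEquiv R M' hU _)
  · exact (singularHomology.isZero_fin R M' (2 * g + 1) (Nat.succ_ne_zero _)).of_iso
      (singularHomology.isoOfHomotopyEquiv R M' hV _)
  · exact (isZero_singularHomology_of_totallyDisconnectedSpace R M' (Nat.succ_ne_zero _)).of_iso
      (singularHomology.isoOfHomotopyEquiv R M' hW _)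

/-- The rational Betti numbers of the base: `b₀ = 1` (path connected), `b₁ = 2g` (`homologyOne_base` and
`bettiNumber_int_eq_rat`), `bₖ = 0` for `k ≥ 2`.  Private copy of `LefschetzBase.bettiNumbers_base`.
[folklore] -/
private theorem bettiNumbers_base' (g : ℕ) :
    bettiNumber ℚ (Base g) 0 = 1 ∧ bettiNumber ℚ (Base g) 1 = 2 * g ∧
      ∀ k, 2 ≤ k → bettiNumber ℚ (Base g) k = 0 := by
  refine ⟨?_, ?_, fun k hk => finrank_eq_zero_of_isZero (isZero_singularHomology_base_of_two_le' ℚ ℚ g hk)⟩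
  · change Module.finrank ℚ (singularHomology ℚ ℚ (Base g) 0) = 1
    rw [(singularHomology.zeroLinearEquivOfPathConnected ℚ ℚ (Base g)).finrank_eq, Module.finrank_self]
  · rw [← bettiNumber_int_eq_rat]
    exact (homologyOne_base g).2.2

end Copies

/-- **`χ(X) = χ(Base g) + n` for a Kosinski multi-attachment `X` of `n` 2-handles on the standard
Lefschetz base**, with the finiteness of `H_•(X; ℤ)` (Kosinski 1993, VI §6 / Kirby 1989, I §1): the
hypothesis `hχ` of `stub_modelsOn_counts_length_of_betti`, from `stub_modelsOn_counts_eulerHandles` and the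
model Euler characteristics `stub_modelsOn_counts_eulerHandleModels 2` (the base instance of
`relEuler_of_isMultiAttachment_four`, `…EulerAssembly.lean`). [folklore] -/
theorem relEuler_of_isMultiAttachment_base (g n : ℕ) (h : Fin n → HandleAttachingMap 3 2 (Base g))
    (X : Type) [TopologicalSpace X] [ChartedSpace (EuclideanHalfSpace 4) X]
    (hX : HandleAttachingMap.IsMultiAttachment h (𝓡∂ 4) X) :
    FinRelHomology ℤ ℤ X ∅ (2 * n + 9) ∧ relEuler ℤ ℤ X ∅ = relEuler ℤ ℤ (Base g) ∅ + n :=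
  have hM := stub_modelsOn_counts_eulerHandleModels 2
  stub_modelsOn_counts_eulerHandles hM.1 hM.2.1 hM.2.2.1 hM.2.2.2 (Base g) n h X hX

/-- **`χ(X) = 1 − 2g + l.length` for a Lefschetz handlebody `X` of word `l` over the genus-`g` base**
(`IsLefschetzHandlebody g l X`: a Kosinski multi-attachment of `l.length` 2-handles on `Base g`), with the
finiteness of `H_•(X; ℤ)`: `χ(X) = χ(Base g) + l.length` and `χ(Base g) = 1 − 2g` (Milnor 1968, Thm. 9.1;
`LefschetzBase.relEuler_base`).  E.g. `χ(X) = 1 + 2g` for the models of homotopy 4-spheres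
(`l.length = 4g`), the value entering Etnyre–Fuller's `d₃` count. [folklore] -/
theorem relEuler_of_isLefschetzHandlebody {g : ℕ} {l : List ((Fin g ⊕ Fin g → ℤ) × Bool)} (X : Type)
    [TopologicalSpace X] [ChartedSpace (EuclideanHalfSpace 4) X] (hX : IsLefschetzHandlebody g l X) :
    FinRelHomology ℤ ℤ X ∅ (2 * l.length + 9) ∧ relEuler ℤ ℤ X ∅ = 1 - 2 * g + l.length := by
  obtain ⟨h, -, hmulti⟩ := hX
  obtain ⟨hfin, hχ⟩ := relEuler_of_isMultiAttachment_base g l.length h X hmulti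
  exact ⟨hfin, by rw [hχ, relEuler_base_of_betti g (bettiNumbers_base' g)]⟩

/-- **The handlebody side of a one-sided model of a homotopy 4-sphere is connected with `H₁(X; ℚ) = 0`**,
unconditionally: `exists_isLefschetzHandlebody_of_modelsOn` (`…StubModelsOnCounts.lean`: Mayer–Vietoris /
excision / duality bookkeeping over the gluing `M = X ∪_Ψ Base g`, Gompf–Stipsicz 1999 §8.2) with its inputs
`H₂(Base g; ℚ) = H₃(Base g; ℚ) = 0` supplied by `LefschetzBase.isZero_singularHomology_base_of_two_le`
(Milnor 1968, Thm. 9.1). [folklore] -/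
theorem exists_isLefschetzHandlebody_of_modelsOn_sphere {M : Type} [TopologicalSpace M] [T2Space M]
    [SecondCountableTopology M] [ChartedSpace (EuclideanSpace ℝ (Fin 4)) M] [IsManifold (𝓡 4) ∞ M]
    {g : ℕ} {l : List ((Fin g ⊕ Fin g → ℤ) × Bool)}
    (e : M ≃ₕ Metric.sphere (0 : EuclideanSpace ℝ (Fin 5)) 1) (hM : ModelsOn M g l) :
    ∃ (X : Type) (_ : TopologicalSpace X) (_ : T2Space X) (_ : SecondCountableTopology X)
      (_ : CompactSpace X) (_ : ChartedSpace (EuclideanHalfSpace 4) X) (_ : IsManifold (𝓡∂ 4) ∞ X),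
      IsLefschetzHandlebody g l X ∧ ConnectedSpace X ∧ IsZero (singularHomology ℚ ℚ X 1) :=
  exists_isLefschetzHandlebody_of_modelsOn e hM (isZero_singularHomology_base_of_two_le' ℚ ℚ g le_rfl) (isZero_singularHomology_base_of_two_le' ℚ ℚ g (by norm_num))

/-- **Sub-goal `stub_modelsOn_counts_length` of stub `stub_modelsOn_counts`** (line `modp-braid-orbits`,
r9): the first clause `l.length = 4 * g` of `LefschetzBase.modelsOn_counts_of_homotopyEquiv_sphere`
(Gompf–Stipsicz 1999, §8.2; Etnyre–Fuller 2006, §2) for every one-sided Lefschetz model `ModelsOn M g l`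
of a homotopy 4-sphere `M`, unconditionally: `2 = χ(M) = χ(X) + χ(Base g) − χ(∂X) =
(1 − 2g + l.length) + (1 − 2g) − 0`. [folklore] -/
theorem stub_modelsOn_counts_length :
    ∀ (M : Type) [TopologicalSpace M] [T2Space M] [SecondCountableTopology M]
      [ChartedSpace (EuclideanSpace ℝ (Fin 4)) M] [IsManifold (𝓡 4) ∞ M] (g : ℕ)
      (l : List ((Fin g ⊕ Fin g → ℤ) × Bool)),
      M ≃ₕ Metric.sphere (0 : EuclideanSpace ℝ (Fin 5)) 1 → ModelsOn M g l → l.length = 4 * g :=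
  stub_modelsOn_counts_length_of_betti
    (fun g n h X _ _ _ _ _ _ hX => (relEuler_of_isMultiAttachment_base g n h X hX).2)
    bettiNumbers_base'

end Summit.SmoothPoincare4.SmoothPoincare4.Theorems.AcyclicBisectionExists.ModpBraidOrbits

end
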